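import Literature.AlgebraicGeometry.Resolution.LocalBlowupModels
import Literature.AlgebraicGeometry.Resolution.RegularLocalRingsNormal
import Mathlib.Algebra.CharP.Lemmas
import Mathlib.Algebra.CharP.Algebra
import Mathlib.RingTheory.IntegralClosure.IntegrallyClosed
import Mathlib.Algebra.Field.Subfield.Basic
import HarnessLib

/-!
# Crux `Steer` (stmt-ResolutionOfSingularities-16345), chain W4.1, R2 σ_top line: piece **E
# `SteeredRunExists`** (CRUX-PLAN-Steer v3 §R2, `L/w41/Sketch-R2-steered.lean` §3.4) — Theses-free body

OURS (campaign `res-hironaka`, rung L, slot W4.1, chain W4.1, unit `res-L0-w41-stub-8` carried by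
`res-D-pv-012`; replaces the role of no printed item; NOT a statement of the manuscript under review;
AI-produced, weaker than expert review).

σ_top-steered runs of the `α_p`-torsor `T ^ p = t ^ p` over the base along `O`: at a stage `(S, σ)` one
blows up, with respect to `O` (`IsLocalBlowupAlong`, NSp Def. 2.11), a PERMISSIBLE centre `P` or the
closed point, and passes to the strict transform `σ' = (σ - g) / u₀`. Piece **E**: from the core datum
such a run reaches an EXIT or a STALL at a finite stage, or goes on for ever. Here:
`steeredRun_dichotomy` — the content, GENERIC in the two atomic predicates of the sub-plan (`Sing`
«singular over the closed point», `Perm` «permissible centre»; only `Perm S f P → ∃ g, f - g ^ p ∈ P ^ p`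
is consumed) with the MINIMAL binders used (`p` prime, `CharP k p`, `A₀.FG`, `t ^ p ∈ A₀`, the base
regular at the centre of `O`, `t ^ p` not a `p`-th power there). The LITERAL piece (sketch vocabulary
unfolded) is `SteeredRun.steeredRunExists` in `FrobeniusClosingSteerCore4SteeredRunExistsLiteral.lean`;
with the sketch's names in scope it is also `steeredRun_dichotomy (fun S _ f => IsSingPrime S p f
(maximalIdeal S)) (fun S _ f P => IsPermissibleCentre S p f P) p hp (fun S _ f P h => h.2.2.2) O A₀ h₀ t
hfg htp hreg hc` (kernel-checked against a verbatim replica of the sketch's definitions).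

Proof. Invariant: `S` is a local blowing up of `A₀` w.r.t. `O` (local, dominated by `O`, Noetherian),
`σ ^ p ∈ S`, `S ⊆ Frac A₀`, `σ ∉ Frac A₀` (at stage `0` by NORMALITY of the regular local ring at the
centre, `isIntegrallyClosed_of_isRegularLocalRing`). A σ_top centre `P` carries a cleaner `g`,
`σ ^ p - g ^ p ∈ P ^ p`, so `P ≠ ⊥` (else `σ = g` by Frobenius), `P` is finitely generated, the local
blowing up `S'` along `P` exists (`exists_isLocalBlowupAlong`) with `P • S' = u₀ • S'`
(`IsLocalBlowupAlong.exists_span_singleton`), hence `σ' := (σ - g) / u₀` has `σ' ^ p ∈ S'`. Dependent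
choice as in the landed `stub_core4RunTrichotomy` (p473559).
[cite: NovacoskiSpivakovsky2014, Def. 2.11] [cite: Matsumura1987, Thm. 19.4] [folklore]
-/

set_option linter.dupNamespace false -- layout-mandated `Summit.<S>.<S>.…` (single-conjunct summit)

open IsLocalRing Literature.AlgebraicGeometry.Resolution

namespace Summit.ResolutionOfSingularities.ResolutionOfSingularities.Theorems.SwitchingDichotomy

namespace SteeredRun

variable {k K : Type} [Field k] [Field K] [Algebra k K]

/-! ## Bookkeeping: subfields, Noetherianity of the members of a tower -/

/-- The local ring at the centre of `B` stays inside any subfield containing `B` (its elements are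
quotients of elements of `B`). [folklore] -/
theorem locAtCentre_subset_subfield (O : ValuationSubring K) {B : Subring K} {F : Subfield K}
    (h : (B : Set K) ⊆ F) : ((locAtCentre B O : Subring K) : Set K) ⊆ F := by
  rintro _ ⟨y, hy, z, hz, -, rfl⟩
  exact F.div_mem (h hy) (h hz)

/-- A subring generated inside a subfield stays inside it. [folklore] -/
theorem closure_union_subset_subfield {B : Subring K} {T : Set K} {F : Subfield K}
    (hB : (B : Set K) ⊆ F) (hT : T ⊆ F) : ((Subring.closure ((B : Set K) ∪ T) : Subring K) : Set K) ⊆ F :=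
  fun _ hx => (Subring.closure_le (t := F.toSubring)).mpr (Set.union_subset hB hT) hx

/-- **A local blowing up of a finitely generated `k`-algebra `A₀ ⊆ O` is Noetherian**: it is the
localisation at the centre of `O` of the finitely generated model `A₀[t]`.
[cite: NovacoskiSpivakovsky2014, Def. 2.8] -/
theorem isNoetherianRing_of_isLocalBlowup (O : ValuationSubring K) (A₀ : Subalgebra k K) (hfg : A₀.FG)
    {S : Subring K} (H : IsLocalBlowup O A₀.toSubring S) : IsNoetherianRing S := by
  classical
  obtain ⟨h₀, T, hT, rfl⟩ := H
  have e : Subring.closure ((A₀.toSubring : Set K) ∪ ↑T) =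
      (Algebra.adjoin k ((A₀ : Set K) ∪ ↑T)).toSubring :=
    closure_subalgebra_union_eq A₀ (↑T : Set K)
  have hCO : Subring.closure ((A₀.toSubring : Set K) ∪ ↑T) ≤ O.toSubring :=
    Subring.closure_le.mpr (Set.union_subset h₀ hT)
  set A' : Subalgebra k K := Algebra.adjoin k ((A₀ : Set K) ∪ ↑T) with hA'
  have hfg' : A'.FG := fg_adjoin_subalgebra_union A₀ hfg T
  haveI : Algebra.FiniteType k A' := (Subalgebra.fg_iff_finiteType A').mp hfg'
  have hNA : IsNoetherianRing A'.toSubring := Algebra.FiniteType.isNoetherianRing k A'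
  have hA'O : A'.toSubring ≤ O.toSubring := e ▸ hCO
  rw [e]
  haveI := isLocalization_locAtCentre (B := A'.toSubring) (O := O) hA'O
  exact IsLocalization.isNoetherianRing (subringCentre A'.toSubring O hA'O).primeCompl
    (locAtCentre A'.toSubring O) hNA

/-! ## One σ_top step: the local blowing up along the centre and the strict transform -/

section Step

variable (O : ValuationSubring K) (A₀ : Subalgebra k K) {p : ℕ}

/-- **The step.** Let `S` be a local blowing up of the finitely generated `A₀` with respect to `O`,
`S ⊆ Frac A₀`, `σ ^ p ∈ S`, `σ ∉ Frac A₀` (`p` prime, characteristic `p`), and let `P` be an ideal of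
`S` carrying a `p`-th power cleaner: `σ ^ p - g ^ p ∈ P ^ p` for some `g ∈ S`. Then the local blowing
up `S'` of `S` along `P` with respect to `O` exists, `σ = u₀ * σ' + g` is a strict-transform step
(`u₀ ∈ P` of maximal `O`-value on `P`, `u₀ ≠ 0`), and `(S', σ')` satisfies the same four conditions.
[cite: NovacoskiSpivakovsky2014, Def. 2.11] [folklore] -/
theorem exists_step (hp : p.Prime) [CharP K p] (hfg : A₀.FG) {S : Subring K}
    (hS : IsLocalBlowup O A₀.toSubring S) (hSF : (S : Set K) ⊆ Subfield.closure (A₀ : Set K))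
    {σ : K} (hσS : σ ^ p ∈ S) (hσF : σ ∉ Subfield.closure (A₀ : Set K))
    {P : Ideal S} (hg : ∃ g : S, (⟨σ ^ p, hσS⟩ : S) - g ^ p ∈ P ^ p) :
    ∃ (S' : Subring K) (σ' : K), IsLocalBlowupAlong O S P S' ∧
      (∃ x g : K, ((∃ hx : x ∈ S, (⟨x, hx⟩ : S) ∈ P) ∧ x ≠ 0 ∧
          ∀ y : S, y ∈ P → O.valuation (y : K) ≤ O.valuation x) ∧ g ∈ S ∧ σ = x * σ' + g) ∧
      IsLocalBlowup O A₀.toSubring S' ∧ (S' : Set K) ⊆ Subfield.closure (A₀ : Set K) ∧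
      σ' ^ p ∈ S' ∧ σ' ∉ Subfield.closure (A₀ : Set K) := by
  classical
  haveI := Fact.mk hp
  set F₀ := Subfield.closure (A₀ : Set K) with hF₀
  have hSO : S ≤ O.toSubring := hS.target_le
  haveI : IsNoetherianRing S := isNoetherianRing_of_isLocalBlowup O A₀ hfg hS
  obtain ⟨g, hgP⟩ := hg
  -- `P ≠ ⊥`: otherwise `σ ^ p = g ^ p`, `σ = g ∈ S ⊆ Frac A₀`
  have hP0 : P ≠ ⊥ := by
    intro hP
    have h1 : (⟨σ ^ p, hσS⟩ : S) - g ^ p ∈ (⊥ : Ideal S) := by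
      have := Ideal.pow_le_self hp.ne_zero hgP
      rwa [hP] at this
    rw [Ideal.mem_bot, sub_eq_zero] at h1
    have h2 : σ ^ p = (g : K) ^ p := by
      have := congrArg (fun z : S => (z : K)) h1
      simpa using this
    have h3 : (σ - (g : K)) ^ p = 0 := by rw [sub_pow_char, h2, sub_self]
    have h4 : σ = (g : K) := sub_eq_zero.mp (pow_eq_zero_iff hp.ne_zero |>.mp h3)
    exact hσF (h4 ▸ hSF g.2)
  have hPfg : P.FG := IsNoetherian.noetherian P
  obtain ⟨S', H⟩ := exists_isLocalBlowupAlong hSO P hPfg hP0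
  have hSS' : S ≤ S' := H.isLocalBlowup.le
  have hS'O : S' ≤ O.toSubring := H.isLocalBlowup.target_le
  obtain ⟨u₀, hu₀P, hdiv⟩ := H.exists_span_singleton
  have hu0 : ((u₀ : S) : K) ≠ 0 := by -- `u₀ ≠ 0` since `P ≠ ⊥`
    refine fun h0 => hP0 ((Submodule.eq_bot_iff _).mpr fun y hy => ?_)
    obtain ⟨y', -, hy'⟩ := hdiv y hy
    exact Subtype.ext (by rw [hy', h0, mul_zero]; rfl)
  have hmax : ∀ y : S, y ∈ P → O.valuation (y : K) ≤ O.valuation ((u₀ : S) : K) := by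
    intro y hy -- maximal value on `P`: `y = y' u₀` with `y' ∈ S' ⊆ O`
    obtain ⟨y', hy'S, hy'⟩ := hdiv y hy
    rw [hy', map_mul]
    calc O.valuation y' * O.valuation ((u₀ : S) : K) ≤ 1 * O.valuation ((u₀ : S) : K) :=
          mul_le_mul_left ((O.valuation_le_one_iff _).mpr (hS'O hy'S)) _
      _ = O.valuation ((u₀ : S) : K) := one_mul _
  -- `P ^ p • S' = u₀ ^ p • S'`: the cleaner's error is `c * u₀ ^ p` with `c ∈ S'`
  have hPmap : Ideal.map (Subring.inclusion hSS') P ≤ Ideal.span {Subring.inclusion hSS' u₀} := by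
    rw [Ideal.map_le_iff_le_comap]
    intro y hy
    obtain ⟨y', hy'S, hy'⟩ := hdiv y hy
    rw [Ideal.mem_comap, Ideal.mem_span_singleton']
    exact ⟨⟨y', hy'S⟩, Subtype.ext (by simpa using hy'.symm)⟩
  have hc : ∃ c : K, c ∈ S' ∧ σ ^ p - (g : K) ^ p = c * ((u₀ : S) : K) ^ p := by
    have h1 : Subring.inclusion hSS' ((⟨σ ^ p, hσS⟩ : S) - g ^ p) ∈
        Ideal.span {Subring.inclusion hSS' u₀ ^ p} := by
      have h2 := Ideal.mem_map_of_mem (Subring.inclusion hSS') hgP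
      rw [Ideal.map_pow] at h2
      have h3 := Ideal.pow_right_mono (n := p) hPmap h2
      rwa [Ideal.span_singleton_pow] at h3
    obtain ⟨c, hc⟩ := Ideal.mem_span_singleton'.mp h1
    refine ⟨c, c.2, ?_⟩
    have := congrArg (fun z : S' => (z : K)) hc
    simpa using this.symm
  obtain ⟨c, hcS', hceq⟩ := hc
  -- the strict transform
  set σ' : K := (σ - g) / ((u₀ : S) : K) with hσ'
  have hstep : σ = ((u₀ : S) : K) * σ' + g := by
    rw [hσ', mul_div_cancel₀ _ hu0]; ring
  have hσ'p : σ' ^ p = c := by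
    rw [hσ', div_pow, sub_pow_char, hceq, mul_div_assoc, div_self (pow_ne_zero _ hu0), mul_one]
  refine ⟨S', σ', H, ⟨(u₀ : S), g, ⟨⟨u₀.2, by simpa using hu₀P⟩, hu0, hmax⟩, g.2, hstep⟩,
    hS.trans H.isLocalBlowup, ?_, hσ'p ▸ hcS', ?_⟩
  · -- `S' ⊆ Frac A₀`
    obtain ⟨-, u, u₁, -, -, -, -, hS'eq⟩ := id H
    rw [hS'eq]
    refine locAtCentre_subset_subfield O (closure_union_subset_subfield hSF ?_)
    rintro _ ⟨x, -, rfl⟩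
    exact F₀.div_mem (hSF x.2) (hSF u₁.2)
  · -- `σ' ∉ Frac A₀`
    intro hσ'F
    exact hσF (hstep ▸ F₀.add_mem (F₀.mul_mem (hSF u₀.2) hσ'F) (hSF g.2))

end Step

/-! ## Stage `0`: the radicand generator is not a fraction of the base -/

section Init

variable (O : ValuationSubring K) (A₀ : Subalgebra k K) (h₀ : A₀.toSubring ≤ O.toSubring) {p : ℕ}

/-- The local ring of the base at the centre lies in `Frac A₀`. [folklore] -/
theorem locAtCentre_subset_closure :
    ((locAtCentre A₀.toSubring O : Subring K) : Set K) ⊆ Subfield.closure (A₀ : Set K) :=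
  locAtCentre_subset_subfield O fun _ hx => Subfield.subset_closure hx

/-- **`t ∉ Frac A₀`.** If the base is regular at the centre of `O` and `t ^ p` (`p ≠ 0`) is not a
`p`-th power in the local ring of the base at the centre, then `t` is not a fraction of elements of
`A₀`: that local ring is NORMAL (regular local rings are integrally closed, Matsumura 19.4), so
`z ^ p ∣ y ^ p` forces `z ∣ y` there (`IsIntegrallyClosed.pow_dvd_pow_iff`).
[cite: Matsumura1987, Thm. 19.4] [folklore] -/
theorem not_mem_closure_of_ne_pow (hp : p ≠ 0) (t : K) (htp : t ^ p ∈ A₀)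
    (hreg : IsRegularLocalRing (Localization.AtPrime
      (Ideal.comap (Subring.inclusion h₀) (IsLocalRing.maximalIdeal O))))
    (hc : ∀ c : Localization.AtPrime (Ideal.comap (Subring.inclusion h₀) (IsLocalRing.maximalIdeal O)),
      algebraMap A₀.toSubring (Localization.AtPrime (Ideal.comap (Subring.inclusion h₀)
        (IsLocalRing.maximalIdeal O))) ⟨t ^ p, htp⟩ ≠ c ^ p) :
    t ∉ Subfield.closure (A₀ : Set K) := by
  classical
  set L₀ := locAtCentre A₀.toSubring O with hL₀
  haveI hregL : IsRegularLocalRing L₀ := (isRegularLocalRing_locAtCentre_iff h₀).mpr hreg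
  haveI : IsIntegrallyClosed L₀ := isIntegrallyClosed_of_isRegularLocalRing L₀
  -- `t ^ p` is not a `p`-th power in `L₀ ⊆ K` either
  have hc' : ∀ c : K, c ∈ L₀ → c ^ p ≠ t ^ p := by
    intro c hcL hct
    have e := locAtCentreEquiv (B := A₀.toSubring) (O := O) h₀
    have h1 : (⟨c, hcL⟩ : L₀) ^ p = algebraMap A₀.toSubring L₀ ⟨t ^ p, htp⟩ := by
      apply Subtype.ext
      rw [Subring.coe_pow, locAtCentre.algebraMap_apply]
      exact hct
    have h2 : algebraMap A₀.toSubring (Localization.AtPrime (subringCentre A₀.toSubring O h₀))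
        ⟨t ^ p, htp⟩ = (e.symm ⟨c, hcL⟩) ^ p := by
      rw [← map_pow, h1]
      exact (e.symm.commutes _).symm
    exact hc _ h2
  intro ht
  obtain ⟨y, hy, z, hz, hyz⟩ := Subfield.mem_closure_iff.mp ht
  have hyA : y ∈ A₀.toSubring := (Subring.closure_le (t := A₀.toSubring)).mpr (fun _ h => h) hy
  have hzA : z ∈ A₀.toSubring := (Subring.closure_le (t := A₀.toSubring)).mpr (fun _ h => h) hz
  by_cases hz0 : z = 0
  · -- `t = y / 0 = 0`
    have ht0 : t = 0 := by rw [← hyz, hz0, div_zero]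
    exact hc' 0 L₀.zero_mem (by rw [ht0, zero_pow hp])
  · set yL : L₀ := ⟨y, le_locAtCentre _ O hyA⟩ with hyL
    set zL : L₀ := ⟨z, le_locAtCentre _ O hzA⟩ with hzL
    have htL : t ^ p ∈ L₀ := le_locAtCentre _ O htp
    have hdvd : zL ^ p ∣ yL ^ p := by
      refine ⟨⟨t ^ p, htL⟩, Subtype.ext ?_⟩
      change y ^ p = z ^ p * t ^ p
      rw [← hyz, div_pow, mul_div_cancel₀ _ (pow_ne_zero _ hz0)]
    obtain ⟨c, hc1⟩ := (IsIntegrallyClosed.pow_dvd_pow_iff hp).mp hdvd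
    have hyc : y = z * (c : K) := by
      have := congrArg (fun w : L₀ => (w : K)) hc1
      simpa using this
    have htc : t = (c : K) := by
      rw [← hyz, hyc, mul_div_cancel_left₀ _ hz0]
    exact hc' c c.2 (by rw [htc])

end Init

/-! ## The dichotomy: exit-or-stall at a finite stage, or an eternal σ_top-steered run -/

section Dichotomy

variable (Sing : ∀ S : Subring K, IsLocalRing S → S → Prop)
  (Perm : ∀ S : Subring K, IsLocalRing S → S → Ideal S → Prop)

/-- **E, generic form.** Let `Sing S f` («the torsor `T ^ p = f` is singular over the closed point of
`S`») and `Perm S f P` («`P` is a σ_top-permissible centre for `f` over `S`») be ANY predicates such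
that a permissible centre carries a `p`-th power cleaner (`Perm S f P → ∃ g, f - g ^ p ∈ P ^ p`). For
`p` prime, `CharP k p`, `A₀ ⊆ O` finitely generated, `t ^ p ∈ A₀`, the base regular at the centre of
`O` and `t ^ p` not a `p`-th power in the local ring there: EITHER some σ_top-steered run from
`(A₀)_{𝔪_O ∩ A₀}` — at each stage `i < N` the centre `P i` is permissible, or is the closed point when
no permissible centre exists and `f` has multiplicity `≥ p` after cleaning; `R (i+1)` is the local
blowing up of `R i` along `P i` with respect to `O`; `s (i+1)` is a strict transform of `s i` — reaches
at stage `N` an EXIT (`¬ Sing`) or a STALL (`Sing`, no permissible centre, multiplicity `< p` after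
every cleaning), OR there is an ETERNAL such run. (Dependent choice over the step `exists_step`.)
[cite: NovacoskiSpivakovsky2014, Def. 2.11] [folklore] -/
theorem steeredRun_dichotomy (p : ℕ) (hp : p.Prime) [CharP k p]
    (hPerm : ∀ (S : Subring K) (hS : IsLocalRing S) (f : S) (P : Ideal S),
      Perm S hS f P → ∃ g : S, f - g ^ p ∈ P ^ p)
    (O : ValuationSubring K) (A₀ : Subalgebra k K) (h₀ : A₀.toSubring ≤ O.toSubring) (t : K)
    (hfg : A₀.FG) (htp : t ^ p ∈ A₀)
    (hreg : IsRegularLocalRing (Localization.AtPrime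
      (Ideal.comap (Subring.inclusion h₀) (IsLocalRing.maximalIdeal O))))
    (hc : ∀ c : Localization.AtPrime (Ideal.comap (Subring.inclusion h₀) (IsLocalRing.maximalIdeal O)),
      algebraMap A₀.toSubring (Localization.AtPrime (Ideal.comap (Subring.inclusion h₀)
        (IsLocalRing.maximalIdeal O))) ⟨t ^ p, htp⟩ ≠ c ^ p) :
    (∃ (R : ℕ → Subring K) (P : (i : ℕ) → Ideal (R i)) (s : ℕ → K) (N : ℕ),
        R 0 = locAtCentre A₀.toSubring O ∧
        (s 0 = t ∧ (∀ i ≤ N, s i ^ p ∈ R i) ∧ ∀ i < N, ∃ (hL : IsLocalRing (R i)) (hs : s i ^ p ∈ R i),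
          (Perm (R i) hL ⟨s i ^ p, hs⟩ (P i) ∨
            (P i = maximalIdeal (R i) ∧ (∀ Q : Ideal (R i), ¬ Perm (R i) hL ⟨s i ^ p, hs⟩ Q) ∧
              ∃ g : R i, (⟨s i ^ p, hs⟩ : R i) - g ^ p ∈ maximalIdeal (R i) ^ p)) ∧
          IsLocalBlowupAlong O (R i) (P i) (R (i + 1)) ∧
          ∃ x g : K, ((∃ hx : x ∈ R i, (⟨x, hx⟩ : R i) ∈ P i) ∧ x ≠ 0 ∧
            ∀ y : R i, y ∈ P i → O.valuation (y : K) ≤ O.valuation x) ∧ g ∈ R i ∧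
            s i = x * s (i + 1) + g) ∧
        ((∃ (hL : IsLocalRing (R N)) (hs : s N ^ p ∈ R N), ¬ Sing (R N) hL ⟨s N ^ p, hs⟩) ∨
          (∃ (hL : IsLocalRing (R N)) (hs : s N ^ p ∈ R N), Sing (R N) hL ⟨s N ^ p, hs⟩ ∧
            (∀ Q : Ideal (R N), ¬ Perm (R N) hL ⟨s N ^ p, hs⟩ Q) ∧
            ∀ g : R N, (⟨s N ^ p, hs⟩ : R N) - g ^ p ∉ maximalIdeal (R N) ^ p))) ∨
      (∃ (R : ℕ → Subring K) (P : (i : ℕ) → Ideal (R i)) (s : ℕ → K),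
        R 0 = locAtCentre A₀.toSubring O ∧
        (s 0 = t ∧ ∀ i, ∃ (hL : IsLocalRing (R i)) (hs : s i ^ p ∈ R i),
          (Perm (R i) hL ⟨s i ^ p, hs⟩ (P i) ∨
            (P i = maximalIdeal (R i) ∧ (∀ Q : Ideal (R i), ¬ Perm (R i) hL ⟨s i ^ p, hs⟩ Q) ∧
              ∃ g : R i, (⟨s i ^ p, hs⟩ : R i) - g ^ p ∈ maximalIdeal (R i) ^ p)) ∧
          IsLocalBlowupAlong O (R i) (P i) (R (i + 1)) ∧
          ∃ x g : K, ((∃ hx : x ∈ R i, (⟨x, hx⟩ : R i) ∈ P i) ∧ x ≠ 0 ∧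
            ∀ y : R i, y ∈ P i → O.valuation (y : K) ≤ O.valuation x) ∧ g ∈ R i ∧
            s i = x * s (i + 1) + g)) := by
  classical
  haveI : CharP K p := charP_of_injective_algebraMap (algebraMap k K).injective p
  set F₀ := Subfield.closure (A₀ : Set K) with hF₀
  set L₀ := locAtCentre A₀.toSubring O with hL₀
  -- the per-stage data: centre clause, strict step, invariant, admissible step
  set Centre : (S : Subring K) → IsLocalRing S → S → Ideal S → Prop := fun S hL f P =>
    Perm S hL f P ∨ (P = maximalIdeal S ∧ (∀ Q : Ideal S, ¬ Perm S hL f Q) ∧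
      ∃ g : S, f - g ^ p ∈ maximalIdeal S ^ p) with hCentre
  set Strict : (S : Subring K) → Ideal S → K → K → Prop := fun S P σ σ' =>
    ∃ x g : K, ((∃ hx : x ∈ S, (⟨x, hx⟩ : S) ∈ P) ∧ x ≠ 0 ∧
      ∀ y : S, y ∈ P → O.valuation (y : K) ≤ O.valuation x) ∧ g ∈ S ∧ σ = x * σ' + g with hStrict
  set Inv : Subring K × K → Prop := fun e =>
    IsLocalBlowup O A₀.toSubring e.1 ∧ ((e.1 : Subring K) : Set K) ⊆ F₀ ∧ e.2 ^ p ∈ e.1 ∧ e.2 ∉ F₀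
    with hInv
  set StepOK : Subring K × K → Subring K × K → Prop := fun e e' =>
    ∃ (P : Ideal e.1) (hL : IsLocalRing e.1) (hs : e.2 ^ p ∈ e.1),
      Centre e.1 hL ⟨e.2 ^ p, hs⟩ P ∧ IsLocalBlowupAlong O e.1 P e'.1 ∧ Strict e.1 P e.2 e'.2 ∧ Inv e'
    with hStepOK
  -- stage `0`
  have hInv0 : Inv (L₀, t) :=
    ⟨IsLocalBlowup.locAtCentre_self h₀, locAtCentre_subset_closure O A₀,
      le_locAtCentre _ O htp, not_mem_closure_of_ne_pow O A₀ h₀ hp.ne_zero t htp hreg hc⟩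
  by_contra hnot
  rcases not_or.mp hnot with ⟨hfin, hetern⟩
  -- the recursion
  let e : ℕ → Subring K × K := fun n => Nat.rec (motive := fun _ => Subring K × K) (L₀, t)
    (fun _ eN => if h : ∃ e', StepOK eN e' then Classical.choose h else eN) n
  have he0 : e 0 = (L₀, t) := rfl
  have heS : ∀ N, e (N + 1) = if h : ∃ e', StepOK (e N) e' then Classical.choose h else e N :=
    fun N => rfl
  let R : ℕ → Subring K := fun i => (e i).1
  let s : ℕ → K := fun i => (e i).2
  let P : (i : ℕ) → Ideal (R i) := fun i =>
    if h : ∃ e', StepOK (e i) e' then (Classical.choose_spec h).choose else ⊤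
  have hR0 : R 0 = L₀ := rfl
  have hs0 : s 0 = t := rfl
  -- an admissible step at stage `i` yields the stage clause for `(R i, P i, s i, R (i+1), s (i+1))`
  have hclause : ∀ i, (∃ e', StepOK (e i) e') →
      (∃ (hL : IsLocalRing (R i)) (hs : s i ^ p ∈ R i), Centre (R i) hL ⟨s i ^ p, hs⟩ (P i) ∧
        IsLocalBlowupAlong O (R i) (P i) (R (i + 1)) ∧ Strict (R i) (P i) (s i) (s (i + 1))) ∧
      Inv (e (i + 1)) := by
    intro i h
    have hP : P i = (Classical.choose_spec h).choose := dif_pos h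
    have heq : e (i + 1) = Classical.choose h := by rw [heS i, dif_pos h]
    obtain ⟨hL, hs, hC, hB, hS, hI⟩ := (Classical.choose_spec h).choose_spec
    refine ⟨⟨hL, hs, hP ▸ hC, ?_, ?_⟩, heq ▸ hI⟩
    · change IsLocalBlowupAlong O (R i) (P i) (e (i + 1)).1
      rw [heq, hP]; exact hB
    · change Strict (R i) (P i) (s i) (e (i + 1)).2
      rw [heq, hP]; exact hS
  -- at a stage satisfying the invariant and reached by a run, an admissible step exists
  have hstep : ∀ N, (∀ i ≤ N, Inv (e i)) →
      (∀ i < N, ∃ (hL : IsLocalRing (R i)) (hs : s i ^ p ∈ R i), Centre (R i) hL ⟨s i ^ p, hs⟩ (P i) ∧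
        IsLocalBlowupAlong O (R i) (P i) (R (i + 1)) ∧ Strict (R i) (P i) (s i) (s (i + 1))) →
      ∃ e', StepOK (e N) e' := by
    intro N hInvN hrun
    obtain ⟨hLB, hF, hsp, hσF⟩ := hInvN N le_rfl
    have hL : IsLocalRing (R N) := hLB.isLocalRing
    have hpow : ∀ i ≤ N, s i ^ p ∈ R i := fun i hi => (hInvN i hi).2.2.1
    -- exit / stall are excluded by `hfin`
    have hnoExit : Sing (R N) hL ⟨s N ^ p, hsp⟩ := by
      by_contra hx
      exact hfin ⟨R, P, s, N, hR0, ⟨hs0, hpow, hrun⟩, Or.inl ⟨hL, hsp, hx⟩⟩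
    have hcentre : ∃ P₀ : Ideal (R N), Centre (R N) hL ⟨s N ^ p, hsp⟩ P₀ ∧
        ∃ g : R N, (⟨s N ^ p, hsp⟩ : R N) - g ^ p ∈ P₀ ^ p := by
      by_cases h1 : ∃ Q : Ideal (R N), Perm (R N) hL ⟨s N ^ p, hsp⟩ Q
      · obtain ⟨Q, hQ⟩ := h1
        exact ⟨Q, Or.inl hQ, hPerm _ hL _ Q hQ⟩
      · by_cases h2 : ∃ g : R N, (⟨s N ^ p, hsp⟩ : R N) - g ^ p ∈ maximalIdeal (R N) ^ p
        · exact ⟨maximalIdeal (R N), Or.inr ⟨rfl, fun Q hQ => h1 ⟨Q, hQ⟩, h2⟩, h2⟩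
        · exact (hfin ⟨R, P, s, N, hR0, ⟨hs0, hpow, hrun⟩,
            Or.inr ⟨hL, hsp, hnoExit, fun Q hQ => h1 ⟨Q, hQ⟩, fun g hg => h2 ⟨g, hg⟩⟩⟩).elim
    obtain ⟨P₀, hC, hg⟩ := hcentre
    obtain ⟨S', σ', hB, hS, hLB', hF', hsp', hσF'⟩ :=
      exists_step O A₀ hp hfg hLB hF hsp hσF (P := P₀) hg
    exact ⟨(S', σ'), P₀, hL, hsp, hC, hB, hS, hLB', hF', hsp', hσF'⟩
  -- the eternal run
  have hrun : ∀ N, (∀ i ≤ N, Inv (e i)) ∧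
      ∀ i < N, ∃ (hL : IsLocalRing (R i)) (hs : s i ^ p ∈ R i), Centre (R i) hL ⟨s i ^ p, hs⟩ (P i) ∧
        IsLocalBlowupAlong O (R i) (P i) (R (i + 1)) ∧ Strict (R i) (P i) (s i) (s (i + 1)) := by
    intro N
    induction N with
    | zero =>
      exact ⟨fun i hi => by rw [Nat.le_zero.mp hi, he0]; exact hInv0,
        fun i hi => absurd hi (Nat.not_lt_zero i)⟩
    | succ N ih =>
      obtain ⟨hcl, hI⟩ := hclause N (hstep N ih.1 ih.2)
      refine ⟨fun i hi => ?_, fun i hi => ?_⟩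
      · rcases Nat.lt_or_eq_of_le hi with hi | rfl
        · exact ih.1 i (Nat.lt_succ_iff.mp hi)
        · exact hI
      · rcases Nat.lt_or_eq_of_le (Nat.lt_succ_iff.mp hi) with hi | rfl
        · exact ih.2 i hi
        · exact hcl
  exact hetern ⟨R, P, s, hR0, hs0, fun i => (hrun (i + 1)).2 i (Nat.lt_succ_self i)⟩

end Dichotomy

end SteeredRun

end Summit.ResolutionOfSingularities.ResolutionOfSingularities.Theorems.SwitchingDichotomy
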